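import Mathlib.NumberTheory.LSeries.Nonvanishing
import Mathlib.NumberTheory.Harmonic.ZetaAsymp
import Mathlib.NumberTheory.EulerProduct.DirichletLSeries
import Mathlib.Analysis.SpecialFunctions.Complex.LogBounds
import Mathlib.Algebra.Order.Field.GeomSum
import Literature.NumberTheory.Sieve.PretentiousDistance
import Literature.NumberTheory.LFunctions.MertensElementary
import HarnessLib

/-!
# Pretentious distances to twisted characters via `ζ` and `L(s, χ)` at `σ_x = 1 + 1/log x`

Topic `Literature/NumberTheory/LFunctions`. Everything in this file is PROVED (no `sorry`, no named
facts).

Elementary comparisons between the Granville–Soundararajan distances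
`𝔻(1, χ(n)n^{it}; x)² = ∑_{p ≤ x} (1 - Re χ(p)p^{it}) / p` (`Literature.NumberTheory.Sieve.pretentiousDistSq`,
`Literature.NumberTheory.Sieve.twistedChar` of `PretentiousDistance`) and `log |L(σ_x - it, χ)|`, where `σ_x = 1 + 1/log x`.
They are used in `Literature/NumberTheory/LFunctions/LiouvilleNonpretentious.lean` to verify the
non-pretentiousness hypothesis of Tao (2016) / Matomäki–Radziwiłł–Tao (2015) for the Liouville
function from a bound for `ζ` alone.

Contents (all proved; `[folklore]` except Mertens' second theorem, Hardy–Wright Thm 427;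
from Mathlib's Chebyshev bound `θ(x) ≤ x log 4` (`Chebyshev.theta_le_log4_mul_x`, through
`MertensElementary`), the Euler products in exponential form
(`DirichletCharacter.LSeries_eulerProduct_exp_log`), and the entire function `ζ(s) - 1/(s-1)`
(`riemannZeta_eq_inv_sub_add`, `differentiable_riemannZeta₀`)):
* Chebyshev–Mertens `∑_{p ≤ N} log p / p ≤ log N + log 4` is imported from
  `MertensElementary` (`Literature.NumberTheory.LFunctions.MertensBound.sum_log_div_prime_le`).
* `Literature.NumberTheory.LFunctions.sigmaX` and the weight comparisons (E_b) `Literature.NumberTheory.LFunctions.sum_primesLE_inv_sub_rpow_le`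
  (`∑_{p ≤ x} (1/p - p^{-σ_x}) ≤ 1 + log 4 / log 2`) and (E_c) `Literature.NumberTheory.LFunctions.sum_tail_rpow_neg_sigmaX_le`
  (`∑_{x < p ≤ M} p^{-σ_x} ≤ 2 log 4`).
* `Literature.NumberTheory.LFunctions.primeSum` (`P_c(s) = ∑_p c(p) p^{-s}`) and (KL) `Literature.NumberTheory.LFunctions.abs_sum_re_div_sub_re_primeSum_le`:
  `|∑_{p ≤ x} Re(c(p)p^{it})/p - Re P_c(σ_x - it)| ≤ 1 + log 4/log 2 + 2 log 4` for `|c| ≤ 1`, `x ≥ 3`.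
* (EL) `Literature.NumberTheory.LFunctions.abs_re_primeSum_sub_log_norm_LSeries_le`: `|Re P_χ(s) - log |L(s, χ)|| ≤ ∑_p p^{-2}` for
  `Re s > 1`; `Literature.NumberTheory.LFunctions.abs_re_primeSum_one_sub_log_norm_zeta_le`: the same for `ζ`.
* `Literature.NumberTheory.LFunctions.exists_bound_riemannZeta_sub_inv`: `ζ(s) - 1/(s-1)` is bounded on `[1,2] × [-2,2]`.
* `Literature.NumberTheory.LFunctions.exists_abs_sum_primesLE_inv_sub_loglog_le`: Mertens' second theorem in the qualitative form
  `|∑_{p ≤ x} 1/p - log log x| ≤ C` for `x ≥ x₀`.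
* (D1a) `Literature.NumberTheory.LFunctions.exists_pretentiousDistSq_one_twistedChar_approx`:
  `|𝔻(1, χ(n)n^{it}; x)² - (log log x - log |L(σ_x - it, χ)|)| ≤ C` for `x ≥ x₀`, uniformly in the
  modulus `q`, the character `χ` and `t ∈ ℝ` (`L` = Mathlib `LSeries (χ ·)`, `Re s > 1` only);
  (D1c) `Literature.NumberTheory.LFunctions.exists_pretentiousDistSq_one_zeta_approx`: the case `q = 1`, with `riemannZeta`.

## References
* A. Granville, K. Soundararajan, *Large character sums: pretentious characters and the
  Pólya–Vinogradov theorem*, J. Amer. Math. Soc. 20 (2007), §1 (the distance `𝔻`; cf.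
  `PretentiousDistance`). The comparison of `𝔻(1, χ(n)n^{it}; x)²` with `log |L(1 + 1/log x + it, χ)|`
  is textbook material (Euler product + Mertens); no statement below is attributed to a specific
  source, hence `[folklore]` throughout.

## Design choices
* Constants are explicit or existentially quantified (`∃ x₀ C, ∀ x ≥ x₀, …`) rather than asymptotic
  notation, so that the results plug directly into `∀ᶠ x in atTop` statements downstream.
* `L(s, χ)` enters only through Mathlib's `LSeries (χ ·) s` for `Re s > 1` and `riemannZeta`; no
  analytic continuation is used in this file.
* Prime sums `∑_{p ≤ x}` are over `Nat.primesLE ⌊x⌋₊`, matching `Literature.NumberTheory.Sieve.pretentiousDistSq`.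
-/

open Finset Real

namespace Literature.NumberTheory.LFunctions

/-! ### The comparison abscissa `σ_x = 1 + 1 / log x` -/

/-- `σ_x = 1 + 1/log x`, the abscissa at which prime sums up to `x` are compared with Dirichlet
series. [folklore] -/
noncomputable def sigmaX (x : ℝ) : ℝ := 1 + 1 / Real.log x

/-- `σ_x > 1` for `x > 1`. [folklore] -/
theorem one_lt_sigmaX {x : ℝ} (hx : 1 < x) : 1 < sigmaX x := by
  unfold sigmaX
  have := Real.log_pos hx
  linarith [one_div_pos.2 this]

/-- `σ_x ≤ 2` for `x ≥ e`. [folklore] -/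
theorem sigmaX_le_two {x : ℝ} (hx : Real.exp 1 ≤ x) : sigmaX x ≤ 2 := by
  unfold sigmaX
  have h1 : 1 ≤ Real.log x := by
    rw [← Real.log_exp 1]
    exact Real.log_le_log (Real.exp_pos 1) hx
  have : 1 / Real.log x ≤ 1 := by
    rw [div_le_one (by linarith)]
    exact h1
  linarith

/-- `x^{-1/log x} = e^{-1}`, i.e. `x^{1 - σ_x} = e^{-1}`. [folklore] -/
theorem rpow_one_sub_sigmaX {x : ℝ} (hx : 1 < x) : x ^ (1 - sigmaX x) = Real.exp (-1) := by
  have hx0 : 0 < x := zero_lt_one.trans hx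
  have hlog : Real.log x ≠ 0 := (Real.log_pos hx).ne'
  rw [Real.rpow_def_of_pos hx0, sigmaX]
  congr 1
  field_simp
  ring

/-- For `0 < p` and `1 < x`: `1/p - p^{-σ_x} ≤ (log p / log x) / p` (used for primes
`p ≤ x`). [folklore] -/
theorem inv_sub_rpow_neg_sigmaX_le {x : ℝ} {p : ℕ} (hx : 1 < x) (hp : 0 < p) :
    (p : ℝ)⁻¹ - (p : ℝ) ^ (-sigmaX x) ≤ Real.log p / Real.log x / p := by
  have hp0 : (0 : ℝ) < p := by exact_mod_cast hp
  have hlogx : 0 < Real.log x := Real.log_pos hx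
  -- p^{-σ_x} = p⁻¹ · exp(-(log p)/log x) ≥ p⁻¹ (1 - log p / log x)
  have h1 : (p : ℝ) ^ (-sigmaX x) = (p : ℝ)⁻¹ * Real.exp (-(Real.log p / Real.log x)) := by
    rw [sigmaX, neg_add, Real.rpow_add hp0, Real.rpow_neg_one, Real.rpow_def_of_pos hp0]
    congr 1
    congr 1
    field_simp
  have h2 : 1 - Real.log p / Real.log x ≤ Real.exp (-(Real.log p / Real.log x)) := by
    have := Real.add_one_le_exp (-(Real.log p / Real.log x))
    linarith
  rw [h1]
  have h3 : (p : ℝ)⁻¹ * (1 - Real.log p / Real.log x)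
      ≤ (p : ℝ)⁻¹ * Real.exp (-(Real.log p / Real.log x)) :=
    mul_le_mul_of_nonneg_left h2 (inv_nonneg.2 hp0.le)
  calc (p : ℝ)⁻¹ - (p : ℝ)⁻¹ * Real.exp (-(Real.log p / Real.log x))
      ≤ (p : ℝ)⁻¹ - (p : ℝ)⁻¹ * (1 - Real.log p / Real.log x) := by linarith
    _ = Real.log p / Real.log x / p := by
        field_simp
        ring

/-- **(E_b)** `∑_{p ≤ x} (1/p - p^{-σ_x}) ≤ 1 + log 4 / log 2` for `x ≥ 2`. [folklore] -/
theorem sum_primesLE_inv_sub_rpow_le {x : ℝ} (hx : 2 ≤ x) :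
    ∑ p ∈ Nat.primesLE ⌊x⌋₊, ((p : ℝ)⁻¹ - (p : ℝ) ^ (-sigmaX x))
      ≤ 1 + Real.log 4 / Real.log 2 := by
  have hx1 : 1 < x := by linarith
  have hlogx : 0 < Real.log x := Real.log_pos hx1
  have hlog2 : 0 < Real.log 2 := Real.log_pos (by norm_num)
  have hN : 1 ≤ ⌊x⌋₊ := Nat.le_floor (by norm_num; linarith)
  have hN2 : (2 : ℝ) ≤ ⌊x⌋₊ := by exact_mod_cast Nat.le_floor hx
  have hNx : (⌊x⌋₊ : ℝ) ≤ x := Nat.floor_le (by linarith)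
  calc ∑ p ∈ Nat.primesLE ⌊x⌋₊, ((p : ℝ)⁻¹ - (p : ℝ) ^ (-sigmaX x))
      ≤ ∑ p ∈ Nat.primesLE ⌊x⌋₊, Real.log p / Real.log x / p :=
        Finset.sum_le_sum fun p hp =>
          inv_sub_rpow_neg_sigmaX_le hx1 (Nat.mem_primesLE.1 hp).2.pos
    _ = (∑ p ∈ Nat.primesLE ⌊x⌋₊, Real.log p / p) / Real.log x := by
        rw [Finset.sum_div]
        refine Finset.sum_congr rfl fun p _ => ?_
        ring
    _ ≤ (Real.log ⌊x⌋₊ + Real.log 4) / Real.log x := by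
        gcongr
        exact Literature.NumberTheory.LFunctions.MertensBound.sum_log_div_prime_le _
    _ ≤ (Real.log x + Real.log 4) / Real.log x := by
        gcongr
    _ = 1 + Real.log 4 / Real.log x := by
        field_simp
    _ ≤ 1 + Real.log 4 / Real.log 2 := by
        gcongr


/-! ### (E_c) The tail `∑_{p > x} p^{-σ_x}` is bounded -/

/-- `log x ≥ 1` for `x ≥ e` (used with Mathlib's `Real.exp_one_lt_three` for `x ≥ 3`).
[folklore] -/
theorem one_le_log_of_exp_le {x : ℝ} (hx : Real.exp 1 ≤ x) : 1 ≤ Real.log x := by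
  rw [← Real.log_exp 1]
  exact Real.log_le_log (Real.exp_pos 1) hx

/-- On a block `x e^j ≤ p ≤ x e^{j+1}` of primes: `∑ p^{-σ_x} ≤ (log 4 / log x) e^{-j/log x}`,
by Chebyshev's bound `θ(x e^{j+1}) ≤ x e^{j+1} log 4`. [folklore] -/
theorem sum_block_rpow_neg_sigmaX_le {x : ℝ} (hx : 3 ≤ x) (S : Finset ℕ) (j : ℕ)
    (hS : ∀ p ∈ S, p.Prime ∧ x * Real.exp j ≤ p ∧ (p : ℝ) ≤ x * Real.exp (j + 1)) :
    ∑ p ∈ S, (p : ℝ) ^ (-sigmaX x)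
      ≤ Real.log 4 / Real.log x * Real.exp (-(j / Real.log x)) := by
  have hx0 : 0 < x := by linarith
  have hlogx : 1 ≤ Real.log x := one_le_log_of_exp_le (Real.exp_one_lt_three.le.trans hx)
  have hlogx0 : 0 < Real.log x := by linarith
  set a : ℝ := x * Real.exp j with ha
  have ha0 : 0 < a := mul_pos hx0 (Real.exp_pos _)
  have hloga : Real.log a = Real.log x + j := by
    rw [ha, Real.log_mul hx0.ne' (Real.exp_pos _).ne', Real.log_exp]
  have hxa : Real.log x ≤ Real.log a := by
    rw [hloga]; exact le_add_of_nonneg_right (Nat.cast_nonneg j)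
  have hσ : 0 < sigmaX x := zero_lt_one.trans (one_lt_sigmaX (by linarith))
  -- pointwise bound
  have hterm : ∀ p ∈ S, (p : ℝ) ^ (-sigmaX x) ≤ a ^ (-sigmaX x) / Real.log x * Real.log p := by
    intro p hp
    obtain ⟨hpp, hap, _⟩ := hS p hp
    have hp0 : (0 : ℝ) < p := by exact_mod_cast hpp.pos
    have h1 : (p : ℝ) ^ (-sigmaX x) ≤ a ^ (-sigmaX x) :=
      Real.rpow_le_rpow_of_nonpos ha0 hap (by linarith)
    have h2 : Real.log a ≤ Real.log p := Real.log_le_log ha0 hap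
    have h3 : 1 ≤ Real.log p / Real.log x := by
      rw [le_div_iff₀ hlogx0]; linarith
    calc (p : ℝ) ^ (-sigmaX x) ≤ a ^ (-sigmaX x) * 1 := by rw [mul_one]; exact h1
      _ ≤ a ^ (-sigmaX x) * (Real.log p / Real.log x) := by
          gcongr
      _ = a ^ (-sigmaX x) / Real.log x * Real.log p := by ring
  -- Chebyshev
  have hSsub : S ⊆ Nat.primesLE ⌊x * Real.exp (j + 1)⌋₊ := by
    intro p hp
    obtain ⟨hpp, _, hpb⟩ := hS p hp
    exact Nat.mem_primesLE.2 ⟨Nat.le_floor hpb, hpp⟩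
  have htheta : ∑ p ∈ S, Real.log p ≤ Real.log 4 * (x * Real.exp (j + 1)) := by
    calc ∑ p ∈ S, Real.log (p : ℝ) ≤ ∑ p ∈ Nat.primesLE ⌊x * Real.exp (j + 1)⌋₊, Real.log (p : ℝ) :=
          Finset.sum_le_sum_of_subset_of_nonneg hSsub fun p hp _ =>
            Real.log_nonneg (by exact_mod_cast (Nat.mem_primesLE.1 hp).2.one_lt.le)
      _ = Chebyshev.theta (x * Real.exp (j + 1)) := (Chebyshev.theta_eq_sum_primesLE _).symm
      _ ≤ Real.log 4 * (x * Real.exp (j + 1)) := Chebyshev.theta_le_log4_mul_x (by positivity)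
  -- the algebra `a^{-σ_x} · x e^{j+1} = e^{-j/log x}`
  have halg : a ^ (-sigmaX x) * (x * Real.exp (j + 1)) = Real.exp (-(j / Real.log x)) := by
    have : x * Real.exp (j + 1) = Real.exp (Real.log a + 1) := by
      rw [Real.exp_add (Real.log a), Real.exp_log ha0, ha, Real.exp_add, mul_assoc]
    rw [this, Real.rpow_def_of_pos ha0, ← Real.exp_add, hloga, sigmaX]
    congr 1
    field_simp
    ring
  calc ∑ p ∈ S, (p : ℝ) ^ (-sigmaX x)
      ≤ ∑ p ∈ S, a ^ (-sigmaX x) / Real.log x * Real.log p := Finset.sum_le_sum hterm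
    _ = a ^ (-sigmaX x) / Real.log x * ∑ p ∈ S, Real.log p := by rw [Finset.mul_sum]
    _ ≤ a ^ (-sigmaX x) / Real.log x * (Real.log 4 * (x * Real.exp (j + 1))) := by
        exact mul_le_mul_of_nonneg_left htheta (div_nonneg (Real.rpow_nonneg ha0.le _) hlogx0.le)
    _ = Real.log 4 / Real.log x * (a ^ (-sigmaX x) * (x * Real.exp (j + 1))) := by ring
    _ = Real.log 4 / Real.log x * Real.exp (-(j / Real.log x)) := by rw [halg]

/-- `1 / (1 - e^{-δ}) ≤ 2/δ` for `0 < δ ≤ 1`. [folklore] -/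
theorem one_div_one_sub_exp_neg_le {δ : ℝ} (hδ0 : 0 < δ) (hδ1 : δ ≤ 1) :
    1 / (1 - Real.exp (-δ)) ≤ 2 / δ := by
  have h1 : Real.exp (-δ) ≤ 1 / (1 + δ) := by
    rw [Real.exp_neg, ← one_div]
    exact one_div_le_one_div_of_le (by linarith) (by linarith [Real.add_one_le_exp δ])
  have h2 : 1 / (1 + δ) ≤ 1 - δ / 2 := by
    rw [div_le_iff₀ (by linarith)]
    nlinarith
  have h3 : δ / 2 ≤ 1 - Real.exp (-δ) := by linarith
  calc 1 / (1 - Real.exp (-δ)) ≤ 1 / (δ / 2) :=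
        one_div_le_one_div_of_le (by linarith) h3
    _ = 2 / δ := by field_simp

/-- **(E_c)** For `x ≥ 3` the tails `∑_{x < p ≤ M} p^{-σ_x}` are bounded by `2 log 4`, uniformly in
`M` (blocks `x e^j ≤ p < x e^{j+1}` and Chebyshev's bound). [folklore] -/
theorem sum_tail_rpow_neg_sigmaX_le {x : ℝ} (hx : 3 ≤ x) (M : ℕ) :
    ∑ p ∈ (Nat.primesLE M).filter (fun p : ℕ => x < p), (p : ℝ) ^ (-sigmaX x)
      ≤ 2 * Real.log 4 := by
  have hx0 : 0 < x := by linarith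
  have hlogx : 1 ≤ Real.log x := one_le_log_of_exp_le (Real.exp_one_lt_three.le.trans hx)
  have hlogx0 : 0 < Real.log x := by linarith
  set T := (Nat.primesLE M).filter (fun p : ℕ => x < p) with hT
  set J : ℕ := ⌊Real.log (M / x)⌋₊ with hJ
  let g : ℕ → ℕ := fun p => ⌊Real.log (p / x)⌋₊
  have hmaps : ∀ p ∈ T, g p ∈ Finset.range (J + 1) := by
    intro p hp
    rw [hT, Finset.mem_filter, Nat.mem_primesLE] at hp
    rw [Finset.mem_range, Nat.lt_succ_iff]
    refine Nat.floor_le_floor (Real.log_le_log (div_pos (hx0.trans hp.2) hx0) ?_)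
    gcongr
    exact_mod_cast hp.1.1
  rw [← Finset.sum_fiberwise_of_maps_to hmaps]
  have hfiber : ∀ j ∈ Finset.range (J + 1),
      ∑ p ∈ T with g p = j, (p : ℝ) ^ (-sigmaX x)
        ≤ Real.log 4 / Real.log x * Real.exp (-(j / Real.log x)) := by
    intro j _
    refine sum_block_rpow_neg_sigmaX_le hx _ j fun p hp => ?_
    rw [Finset.mem_filter, hT, Finset.mem_filter, Nat.mem_primesLE] at hp
    obtain ⟨⟨⟨_, hpp⟩, hxp⟩, hgp⟩ := hp
    have hp0 : (0 : ℝ) < p := hx0.trans hxp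
    have hlog0 : 0 ≤ Real.log (p / x) := Real.log_nonneg ((one_le_div hx0).2 hxp.le)
    have hj1 : (j : ℝ) ≤ Real.log (p / x) := by
      have := Nat.floor_le hlog0
      rw [show ⌊Real.log (p / x)⌋₊ = j from hgp] at this
      exact this
    have hj2 : Real.log (p / x) < j + 1 := by
      have := Nat.lt_floor_add_one (Real.log (p / x))
      rw [show ⌊Real.log (p / x)⌋₊ = j from hgp] at this
      exact_mod_cast this
    refine ⟨hpp, ?_, ?_⟩
    · have : Real.exp j ≤ p / x := by
        rw [← Real.exp_log (div_pos hp0 hx0)]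
        exact Real.exp_le_exp.2 hj1
      rwa [le_div_iff₀ hx0, mul_comm] at this
    · have : p / x ≤ Real.exp (j + 1) := by
        rw [← Real.exp_log (div_pos hp0 hx0)]
        exact Real.exp_le_exp.2 hj2.le
      rwa [div_le_iff₀ hx0, mul_comm] at this
  set r : ℝ := Real.exp (-(1 / Real.log x)) with hr
  have hr0 : 0 ≤ r := (Real.exp_pos _).le
  have hr1 : r < 1 := Real.exp_lt_one_iff.2 (by rw [neg_lt_zero]; positivity)
  calc ∑ j ∈ Finset.range (J + 1), ∑ p ∈ T with g p = j, (p : ℝ) ^ (-sigmaX x)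
      ≤ ∑ j ∈ Finset.range (J + 1), Real.log 4 / Real.log x * Real.exp (-(j / Real.log x)) :=
        Finset.sum_le_sum hfiber
    _ = Real.log 4 / Real.log x * ∑ j ∈ Finset.range (J + 1), r ^ j := by
        rw [Finset.mul_sum]
        refine Finset.sum_congr rfl fun j _ => ?_
        rw [hr, ← Real.exp_nat_mul]
        congr 2
        ring
    _ ≤ Real.log 4 / Real.log x * (1 / (1 - r)) := by
        refine mul_le_mul_of_nonneg_left ?_ (div_nonneg (Real.log_nonneg (by norm_num)) hlogx0.le)
        have := geom_sum_Ico_le_of_lt_one (m := 0) (n := J + 1) hr0 hr1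
        rwa [pow_zero, ← Finset.range_eq_Ico] at this
    _ ≤ Real.log 4 / Real.log x * (2 / (1 / Real.log x)) := by
        refine mul_le_mul_of_nonneg_left ?_ (div_nonneg (Real.log_nonneg (by norm_num)) hlogx0.le)
        exact one_div_one_sub_exp_neg_le (by positivity) (by rw [div_le_one hlogx0]; exact hlogx)
    _ = 2 * Real.log 4 := by
        field_simp


/-! ### The prime Dirichlet series `P_c(s) = ∑_p c(p) p^{-s}` -/

open Complex in
/-- The prime-supported Dirichlet series `P_c(s) = ∑_{p prime} c(p) p^{-s}`, written as a sum
over `ℕ` of the function supported on the primes. [folklore] -/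
noncomputable def primeSum (c : ℕ → ℂ) (s : ℂ) : ℂ :=
  ∑' n : ℕ, {p : ℕ | p.Prime}.indicator (fun n => c n * (n : ℂ) ^ (-s)) n

/-- `P_c(s)` as a sum over the subtype of primes. [folklore] -/
theorem primeSum_eq_tsum_primes (c : ℕ → ℂ) (s : ℂ) :
    primeSum c s = ∑' p : Nat.Primes, c p * (p : ℂ) ^ (-s) := by
  unfold primeSum
  exact (tsum_subtype {p : ℕ | p.Prime} (fun n => c n * (n : ℂ) ^ (-s))).symm

/-- The summands of `P_c(s)` are bounded by `n^{-Re s}` when `|c| ≤ 1`. [folklore] -/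
theorem norm_primeSummand_le {c : ℕ → ℂ} (hc : ∀ n, ‖c n‖ ≤ 1) (s : ℂ) (n : ℕ) :
    ‖{p : ℕ | p.Prime}.indicator (fun n => c n * (n : ℂ) ^ (-s)) n‖ ≤ (n : ℝ) ^ (-s.re) := by
  by_cases hn : n.Prime
  · rw [Set.indicator_of_mem (show n ∈ {p : ℕ | p.Prime} from hn), norm_mul,
      Complex.norm_natCast_cpow_of_pos hn.pos, Complex.neg_re]
    calc ‖c n‖ * (n : ℝ) ^ (-s.re) ≤ 1 * (n : ℝ) ^ (-s.re) := by
          gcongr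
          exact hc n
      _ = _ := one_mul _
  · rw [Set.indicator_of_notMem (show n ∉ {p : ℕ | p.Prime} from hn), norm_zero]
    exact Real.rpow_nonneg (Nat.cast_nonneg n) _

/-- `P_c(s)` converges absolutely for `Re s > 1`, `|c| ≤ 1`. [folklore] -/
theorem summable_primeSummand {c : ℕ → ℂ} (hc : ∀ n, ‖c n‖ ≤ 1) {s : ℂ} (hs : 1 < s.re) :
    Summable (fun n : ℕ => {p : ℕ | p.Prime}.indicator (fun n => c n * (n : ℂ) ^ (-s)) n) :=
  Summable.of_norm_bounded (Real.summable_nat_rpow.2 (by linarith)) (norm_primeSummand_le hc s)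

open Complex in
/-- Real part of `c(p) p^{-(σ - it)}`: `Re(c(p) p^{it}) · p^{-σ}`. [folklore] -/
theorem re_mul_cpow_neg_sub (c : ℂ) {p : ℕ} (hp : 0 < p) (σ t : ℝ) :
    (c * (p : ℂ) ^ (-((σ : ℂ) - t * I))).re
      = (c * (p : ℂ) ^ ((t : ℂ) * I)).re * (p : ℝ) ^ (-σ) := by
  have hp0 : (p : ℂ) ≠ 0 := by exact_mod_cast hp.ne'
  have h1 : -((σ : ℂ) - t * I) = (t : ℂ) * I + ((-σ : ℝ) : ℂ) := by push_cast; ring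
  rw [h1, Complex.cpow_add _ _ hp0, ← mul_assoc,
    show ((p : ℂ)) = ((p : ℝ) : ℂ) by norm_cast, ← Complex.ofReal_cpow (Nat.cast_nonneg p),
    Complex.re_mul_ofReal]

open Complex in
/-- **(KL) The key comparison.** For `|c| ≤ 1`, `x ≥ 3` and real `t`,
`|∑_{p ≤ x} Re(c(p) p^{it}) / p - Re P_c(σ_x - it)| ≤ 1 + log 4 / log 2 + 2 log 4`:
the weights `1/p` and `p^{-σ_x}` differ by (E_b), and the tail `p > x` is bounded by (E_c).
[folklore] -/
theorem abs_sum_re_div_sub_re_primeSum_le {c : ℕ → ℂ} (hc : ∀ n, ‖c n‖ ≤ 1) {x : ℝ}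
    (hx : 3 ≤ x) (t : ℝ) :
    |∑ p ∈ Nat.primesLE ⌊x⌋₊, (c p * (p : ℂ) ^ ((t : ℂ) * I)).re / p
        - (primeSum c ((sigmaX x : ℂ) - t * I)).re|
      ≤ (1 + Real.log 4 / Real.log 2) + 2 * Real.log 4 := by
  have hx1 : (1 : ℝ) < x := by linarith
  have hσ1 : 1 < sigmaX x := one_lt_sigmaX hx1
  set s : ℂ := (sigmaX x : ℂ) - t * I with hs
  have hsre : s.re = sigmaX x := by simp [hs]
  have hs1 : 1 < s.re := by rw [hsre]; exact hσ1
  set F : ℕ → ℂ := fun n => {p : ℕ | p.Prime}.indicator (fun n => c n * (n : ℂ) ^ (-s)) n with hF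
  have hFs : Summable F := summable_primeSummand hc hs1
  set N := ⌊x⌋₊ with hN
  -- split the series at `N`
  have hsplit : primeSum c s = ∑ n ∈ Finset.range (N + 1), F n + ∑' n, F (n + (N + 1)) :=
    (hFs.sum_add_tsum_nat_add (N + 1)).symm
  have hfin : ∑ n ∈ Finset.range (N + 1), F n
      = ∑ p ∈ Nat.primesLE N, c p * (p : ℂ) ^ (-s) := by
    rw [show Nat.primesLE N = (Finset.range (N + 1)).filter Nat.Prime from rfl, Finset.sum_filter]
    refine Finset.sum_congr rfl fun n _ => ?_
    simp only [hF, Set.indicator_apply, Set.mem_setOf_eq]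
  have hfinre : (∑ p ∈ Nat.primesLE N, c p * (p : ℂ) ^ (-s)).re
      = ∑ p ∈ Nat.primesLE N, (c p * (p : ℂ) ^ ((t : ℂ) * I)).re * (p : ℝ) ^ (-sigmaX x) := by
    rw [Complex.re_sum]
    refine Finset.sum_congr rfl fun p hp => ?_
    exact re_mul_cpow_neg_sub (c p) (Nat.mem_primesLE.1 hp).2.pos _ _
  -- the finite part: weights `1/p` versus `p^{-σ_x}`
  have hpart1 : |∑ p ∈ Nat.primesLE N, (c p * (p : ℂ) ^ ((t : ℂ) * I)).re / p
      - ∑ p ∈ Nat.primesLE N, (c p * (p : ℂ) ^ ((t : ℂ) * I)).re * (p : ℝ) ^ (-sigmaX x)|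
        ≤ 1 + Real.log 4 / Real.log 2 := by
    rw [← Finset.sum_sub_distrib]
    refine (Finset.abs_sum_le_sum_abs _ _).trans ?_
    refine le_trans (Finset.sum_le_sum fun p hp => ?_) (sum_primesLE_inv_sub_rpow_le (by linarith))
    have hpp := (Nat.mem_primesLE.1 hp).2
    have hp0 : (0 : ℝ) < p := by exact_mod_cast hpp.pos
    have hre : |(c p * (p : ℂ) ^ ((t : ℂ) * I)).re| ≤ 1 := by
      refine (Complex.abs_re_le_norm _).trans ?_
      rw [norm_mul, Complex.norm_natCast_cpow_of_pos hpp.pos]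
      simp only [mul_re, ofReal_re, I_re, mul_zero, ofReal_im, I_im, mul_one, sub_self,
        Real.rpow_zero, mul_one]
      exact hc p
    have hw : (p : ℝ) ^ (-sigmaX x) ≤ (p : ℝ)⁻¹ := by
      rw [← Real.rpow_neg_one]
      exact Real.rpow_le_rpow_of_exponent_le (by exact_mod_cast hpp.one_lt.le) (by linarith)
    rw [div_eq_mul_inv, ← mul_sub, abs_mul, abs_of_nonneg (sub_nonneg.2 hw)]
    calc |(c p * (p : ℂ) ^ ((t : ℂ) * I)).re| * ((p : ℝ)⁻¹ - (p : ℝ) ^ (-sigmaX x))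
        ≤ 1 * ((p : ℝ)⁻¹ - (p : ℝ) ^ (-sigmaX x)) := by gcongr
      _ = _ := one_mul _
  -- the tail
  have htail_s : Summable fun n => ‖F (n + (N + 1))‖ :=
    ((summable_nat_add_iff (N + 1)).2 hFs).norm
  have hpart2 : ‖∑' n, F (n + (N + 1))‖ ≤ 2 * Real.log 4 := by
    refine (norm_tsum_le_tsum_norm htail_s).trans ?_
    refine Real.tsum_le_of_sum_range_le (fun n => norm_nonneg _) fun M => ?_
    have hshift : ∑ n ∈ Finset.range M, ‖F (n + (N + 1))‖
        = ∑ m ∈ Finset.Ico (N + 1) (N + 1 + M), ‖F m‖ := by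
      rw [Finset.sum_Ico_eq_sum_range]
      simp only [add_tsub_cancel_left]
      refine Finset.sum_congr rfl fun n _ => ?_
      rw [add_comm]
    rw [hshift]
    calc ∑ m ∈ Finset.Ico (N + 1) (N + 1 + M), ‖F m‖
        ≤ ∑ m ∈ Finset.Ico (N + 1) (N + 1 + M),
            (if m.Prime then (m : ℝ) ^ (-sigmaX x) else 0) := by
          refine Finset.sum_le_sum fun m _ => ?_
          by_cases hm : m.Prime
          · rw [if_pos hm]
            have := norm_primeSummand_le hc s m
            rwa [hsre] at this
          · simp [hF, hm]
      _ = ∑ m ∈ (Finset.Ico (N + 1) (N + 1 + M)).filter Nat.Prime, (m : ℝ) ^ (-sigmaX x) := by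
          rw [Finset.sum_filter]
      _ ≤ ∑ m ∈ (Nat.primesLE (N + M)).filter (fun p : ℕ => x < p), (m : ℝ) ^ (-sigmaX x) := by
          refine Finset.sum_le_sum_of_subset_of_nonneg (fun m hm => ?_) fun m _ _ =>
            Real.rpow_nonneg (Nat.cast_nonneg m) _
          rw [Finset.mem_filter, Finset.mem_Ico] at hm
          rw [Finset.mem_filter, Nat.mem_primesLE]
          refine ⟨⟨by omega, hm.2⟩, ?_⟩
          have : ⌊x⌋₊ < m := by rw [← hN]; omega
          exact (Nat.floor_lt (by linarith)).1 this
      _ ≤ 2 * Real.log 4 := sum_tail_rpow_neg_sigmaX_le hx _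
  -- assemble
  have hre_split : (primeSum c s).re
      = ∑ p ∈ Nat.primesLE N, (c p * (p : ℂ) ^ ((t : ℂ) * I)).re * (p : ℝ) ^ (-sigmaX x)
        + (∑' n, F (n + (N + 1))).re := by
    rw [hsplit, Complex.add_re, hfin, hfinre]
  rw [hre_split]
  have htail_re : |(∑' n, F (n + (N + 1))).re| ≤ 2 * Real.log 4 :=
    (Complex.abs_re_le_norm _).trans hpart2
  calc |∑ p ∈ Nat.primesLE N, (c p * (p : ℂ) ^ ((t : ℂ) * I)).re / p
        - (∑ p ∈ Nat.primesLE N, (c p * (p : ℂ) ^ ((t : ℂ) * I)).re * (p : ℝ) ^ (-sigmaX x)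
          + (∑' n, F (n + (N + 1))).re)|
      = |(∑ p ∈ Nat.primesLE N, (c p * (p : ℂ) ^ ((t : ℂ) * I)).re / p
          - ∑ p ∈ Nat.primesLE N, (c p * (p : ℂ) ^ ((t : ℂ) * I)).re * (p : ℝ) ^ (-sigmaX x))
          + (-(∑' n, F (n + (N + 1))).re)| := by congr 1; ring
    _ ≤ |∑ p ∈ Nat.primesLE N, (c p * (p : ℂ) ^ ((t : ℂ) * I)).re / p
          - ∑ p ∈ Nat.primesLE N, (c p * (p : ℂ) ^ ((t : ℂ) * I)).re * (p : ℝ) ^ (-sigmaX x)|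
          + |(-(∑' n, F (n + (N + 1))).re)| := abs_add_le _ _
    _ ≤ (1 + Real.log 4 / Real.log 2) + 2 * Real.log 4 := by
        rw [abs_neg]
        exact add_le_add hpart1 htail_re


/-! ### Euler products: `Re P_χ(s) = log |L(s, χ)| + O(1)` for `Re s > 1` -/

/-- `∑_p p^{-2} < ∞`. [folklore] -/
theorem summable_primes_rpow_neg_two : Summable (fun p : Nat.Primes => (p : ℝ) ^ (-2 : ℝ)) :=
  Nat.Primes.summable_rpow.2 (by norm_num)

open Complex in
/-- For `‖z‖ ≤ 1/2`: `‖-log(1 - z) - z‖ ≤ ‖z‖²`. [folklore] -/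
theorem norm_neg_log_one_sub_sub_le {z : ℂ} (hz : ‖z‖ ≤ 1 / 2) :
    ‖-log (1 - z) - z‖ ≤ ‖z‖ ^ 2 := by
  have h := Complex.norm_log_one_add_sub_self_le (z := -z) (by rw [norm_neg]; linarith)
  rw [norm_neg] at h
  have h2 : (1 - ‖z‖)⁻¹ ≤ 2 := by
    rw [inv_le_comm₀ (by linarith) (by norm_num)]
    linarith
  have h3 : -log (1 - z) - z = -(log (1 + -z) - -z) := by
    rw [← sub_eq_add_neg]
    ring
  calc ‖-log (1 - z) - z‖ = ‖log (1 + -z) - -z‖ := by rw [h3, norm_neg]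
    _ ≤ ‖z‖ ^ 2 * (1 - ‖z‖)⁻¹ / 2 := h
    _ ≤ ‖z‖ ^ 2 * 2 / 2 := by gcongr
    _ = ‖z‖ ^ 2 := by ring

open Complex in
/-- `|χ(p) p^{-s}| ≤ p^{-Re s}`. [folklore] -/
theorem norm_char_mul_cpow_le {q : ℕ} (χ : DirichletCharacter ℂ q) (s : ℂ) (p : Nat.Primes) :
    ‖χ p * (p : ℂ) ^ (-s)‖ ≤ (p : ℝ) ^ (-s.re) := by
  rw [norm_mul, Complex.norm_natCast_cpow_of_pos p.prop.pos, neg_re]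
  calc ‖χ p‖ * (p : ℝ) ^ (-s.re) ≤ 1 * (p : ℝ) ^ (-s.re) := by
        gcongr
        exact χ.norm_le_one _
    _ = _ := one_mul _

/-- `p^{-Re s} ≤ 1/2` for a prime `p` and `Re s > 1`. [folklore] -/
theorem primes_rpow_neg_re_le_half {s : ℂ} (hs : 1 < s.re) (p : Nat.Primes) :
    (p : ℝ) ^ (-s.re) ≤ 1 / 2 := by
  have hp2 : (2 : ℝ) ≤ p := by exact_mod_cast p.prop.two_le
  have hp1 : (1 : ℝ) ≤ p := by linarith
  calc (p : ℝ) ^ (-s.re) ≤ (p : ℝ) ^ (-1 : ℝ) :=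
        Real.rpow_le_rpow_of_exponent_le hp1 (by linarith)
    _ = 1 / p := by rw [Real.rpow_neg_one, one_div]
    _ ≤ 1 / 2 := one_div_le_one_div_of_le (by norm_num) hp2

/-- `(p^{-Re s})² ≤ p^{-2}` for a prime `p` and `Re s > 1`. [folklore] -/
theorem primes_rpow_neg_re_sq_le {s : ℂ} (hs : 1 < s.re) (p : Nat.Primes) :
    ((p : ℝ) ^ (-s.re)) ^ 2 ≤ (p : ℝ) ^ (-2 : ℝ) := by
  have hp1 : (1 : ℝ) ≤ p := by exact_mod_cast p.prop.one_lt.le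
  rw [← Real.rpow_natCast, ← Real.rpow_mul (by linarith)]
  exact Real.rpow_le_rpow_of_exponent_le hp1 (by push_cast; linarith)

open Complex in
/-- **(EL)** For a Dirichlet character `χ` and `Re s > 1`:
`|Re P_χ(s) - log |L(s, χ)|| ≤ ∑_p p^{-2}`, from the Euler product
`L(s, χ) = exp(∑_p -log(1 - χ(p) p^{-s}))` (Mathlib) and `|-log(1-z) - z| ≤ |z|²`. [folklore] -/
theorem abs_re_primeSum_sub_log_norm_LSeries_le {q : ℕ} (χ : DirichletCharacter ℂ q) {s : ℂ}
    (hs : 1 < s.re) :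
    |(primeSum (fun n : ℕ => χ n) s).re - Real.log ‖LSeries (fun n : ℕ => χ n) s‖|
      ≤ ∑' p : Nat.Primes, (p : ℝ) ^ (-2 : ℝ) := by
  set z : Nat.Primes → ℂ := fun p => χ p * (p : ℂ) ^ (-s) with hz
  have hzs : Summable z :=
    Summable.of_norm_bounded (Nat.Primes.summable_rpow.2 (by linarith)) (norm_char_mul_cpow_le χ s)
  have hlogs : Summable fun p => -log (1 - z p) := (hzs.clog_one_sub).neg
  have hL := DirichletCharacter.LSeries_eulerProduct_exp_log χ hs
  have hlogL : Real.log ‖LSeries (fun n : ℕ => χ n) s‖ = (∑' p : Nat.Primes, -log (1 - z p)).re := by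
    rw [← hL, Complex.norm_exp, Real.log_exp]
  have hP : primeSum (fun n : ℕ => χ n) s = ∑' p : Nat.Primes, z p := primeSum_eq_tsum_primes _ _
  have hbound : ∀ p : Nat.Primes, ‖z p - -log (1 - z p)‖ ≤ (p : ℝ) ^ (-2 : ℝ) := by
    intro p
    have hzp : ‖z p‖ ≤ (p : ℝ) ^ (-s.re) := norm_char_mul_cpow_le χ s p
    rw [norm_sub_rev]
    calc ‖-log (1 - z p) - z p‖ ≤ ‖z p‖ ^ 2 :=
          norm_neg_log_one_sub_sub_le (hzp.trans (primes_rpow_neg_re_le_half hs p))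
      _ ≤ ((p : ℝ) ^ (-s.re)) ^ 2 := by gcongr
      _ ≤ (p : ℝ) ^ (-2 : ℝ) := primes_rpow_neg_re_sq_le hs p
  have hds : Summable fun p : Nat.Primes => ‖z p - -log (1 - z p)‖ :=
    Summable.of_norm_bounded summable_primes_rpow_neg_two (fun p => by
      rw [norm_norm]; exact hbound p)
  rw [hlogL, hP, ← Complex.sub_re, ← Summable.tsum_sub hzs hlogs]
  refine (Complex.abs_re_le_norm _).trans ?_
  refine (norm_tsum_le_tsum_norm hds).trans ?_
  exact Summable.tsum_le_tsum hbound hds summable_primes_rpow_neg_two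

/-- The Dirichlet character mod `1` is identically `1`. [folklore] -/
theorem dirichletCharacter_modOne_apply (n : ℕ) : (1 : DirichletCharacter ℂ 1) n = 1 :=
  MulChar.one_apply (isUnit_of_subsingleton _)

/-- **(EL) for `ζ`.** For `Re s > 1`: `|Re P_1(s) - log |ζ(s)|| ≤ ∑_p p^{-2}`. [folklore] -/
theorem abs_re_primeSum_one_sub_log_norm_zeta_le {s : ℂ} (hs : 1 < s.re) :
    |(primeSum (fun _ => 1) s).re - Real.log ‖riemannZeta s‖|
      ≤ ∑' p : Nat.Primes, (p : ℝ) ^ (-2 : ℝ) := by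
  have h := abs_re_primeSum_sub_log_norm_LSeries_le (1 : DirichletCharacter ℂ 1) hs
  have h1 : (fun n : ℕ => (1 : DirichletCharacter ℂ 1) n) = fun _ => (1 : ℂ) :=
    funext dirichletCharacter_modOne_apply
  rwa [DirichletCharacter.LSeries_modOne_eq, LSeries_one_eq_riemannZeta hs, h1] at h

/-! ### `ζ(s)` near `s = 1` -/

open Complex in
/-- `ζ(s) - 1/(s-1)` is bounded on the rectangle `1 ≤ Re s ≤ 2`, `|Im s| ≤ 2` (it extends to an
entire function, Mathlib's `riemannZeta₀`). [folklore] -/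
theorem exists_bound_riemannZeta_sub_inv :
    ∃ M : ℝ, 0 ≤ M ∧ ∀ s : ℂ, 1 ≤ s.re → s.re ≤ 2 → |s.im| ≤ 2 → s ≠ 1 →
      ‖riemannZeta s - (s - 1)⁻¹‖ ≤ M := by
  obtain ⟨M, hM⟩ := (IsCompact.reProdIm isCompact_Icc isCompact_Icc :
      IsCompact (Set.Icc (1 : ℝ) 2 ×ℂ Set.Icc (-2 : ℝ) 2)).exists_bound_of_continuousOn
    differentiable_riemannZeta₀.continuous.continuousOn
  refine ⟨max M 0, le_max_right _ _, fun s h1 h2 h3 hs => ?_⟩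
  rw [riemannZeta_eq_inv_sub_add hs, add_sub_cancel_left]
  exact (hM s ⟨⟨h1, h2⟩, abs_le.1 h3⟩).trans (le_max_left _ _)

open Complex in
/-- `1/(σ_x - 1) = log x`. [folklore] -/
theorem sigmaX_sub_one_inv {x : ℝ} (hx : 1 < x) : ((sigmaX x : ℂ) - 1)⁻¹ = (Real.log x : ℂ) := by
  have hlog : (Real.log x : ℂ) ≠ 0 := by exact_mod_cast (Real.log_pos hx).ne'
  rw [sigmaX]
  push_cast
  rw [add_sub_cancel_left, one_div, inv_inv]


/-! ### Mertens' second theorem (two-sided, qualitative form) -/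

open Complex in
/-- `∑_{p ≤ x} 1/p = Re P_1(σ_x) + O(1)`: (KL) with `c = 1`, `t = 0`. [folklore] -/
theorem abs_sum_inv_sub_re_primeSum_le {x : ℝ} (hx : 3 ≤ x) :
    |∑ p ∈ Nat.primesLE ⌊x⌋₊, (p : ℝ)⁻¹ - (primeSum (fun _ => 1) (sigmaX x : ℂ)).re|
      ≤ (1 + Real.log 4 / Real.log 2) + 2 * Real.log 4 := by
  have h := abs_sum_re_div_sub_re_primeSum_le (c := fun _ => (1 : ℂ)) (fun _ => by simp) hx 0
  simpa only [ofReal_zero, zero_mul, cpow_zero, mul_one, one_re, sub_zero, one_div] using h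

open Complex in
/-- **Mertens' second theorem (qualitative, two-sided).** There are `x₀, C` with
`|∑_{p ≤ x} 1/p - log log x| ≤ C` for `x ≥ x₀` (Hardy–Wright Thm 427 gives
`∑_{p ≤ x} 1/p = log log x + B₁ + o(1)`; only the weaker `O(1)` form is proved here); via
`∑_{p ≤ x} 1/p = log ζ(σ_x) + O(1)` and `ζ(σ_x) = log x + O(1)`.
[cite: HardyWright2008, Thm 427 (§22.7)] -/
theorem exists_abs_sum_primesLE_inv_sub_loglog_le :
    ∃ x₀ C : ℝ, 3 ≤ x₀ ∧ ∀ x : ℝ, x₀ ≤ x →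
      |∑ p ∈ Nat.primesLE ⌊x⌋₊, (p : ℝ)⁻¹ - Real.log (Real.log x)| ≤ C := by
  obtain ⟨M, hM0, hM⟩ := exists_bound_riemannZeta_sub_inv
  refine ⟨max 3 (Real.exp (2 * M + 2)), (1 + Real.log 4 / Real.log 2) + 2 * Real.log 4
    + (∑' p : Nat.Primes, (p : ℝ) ^ (-2 : ℝ)) + Real.log 2, le_max_left _ _, fun x hx => ?_⟩
  have hx3 : 3 ≤ x := (le_max_left _ _).trans hx
  have hx1 : 1 < x := by linarith
  have hlogx : 2 * M + 2 ≤ Real.log x := by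
    rw [← Real.log_exp (2 * M + 2)]
    exact Real.log_le_log (Real.exp_pos _) ((le_max_right _ _).trans hx)
  have hlogpos : 0 < Real.log x := by linarith
  have hσ1 := one_lt_sigmaX hx1
  have hσre : 1 < ((sigmaX x : ℂ)).re := by simpa using hσ1
  have h1 := abs_sum_inv_sub_re_primeSum_le hx3
  have h2 := abs_re_primeSum_one_sub_log_norm_zeta_le hσre
  -- ζ(σ_x) = log x + O(1)
  have hζ : ‖riemannZeta (sigmaX x : ℂ) - (Real.log x : ℂ)‖ ≤ M := by
    have hne : (sigmaX x : ℂ) ≠ 1 := by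
      intro h
      have := congrArg Complex.re h
      simp only [ofReal_re, one_re] at this
      linarith
    have := hM (sigmaX x : ℂ) (by simpa using hσ1.le)
      (by simpa using sigmaX_le_two (Real.exp_one_lt_three.le.trans hx3)) (by simp) hne
    rwa [sigmaX_sub_one_inv hx1] at this
  have hlow : Real.log x / 2 ≤ ‖riemannZeta (sigmaX x : ℂ)‖ := by
    have := norm_sub_norm_le (Real.log x : ℂ) (riemannZeta (sigmaX x : ℂ))
    rw [norm_sub_rev, Complex.norm_real, Real.norm_of_nonneg hlogpos.le] at this
    linarith
  have hupp : ‖riemannZeta (sigmaX x : ℂ)‖ ≤ 2 * Real.log x := by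
    have := norm_le_insert' (riemannZeta (sigmaX x : ℂ)) (Real.log x : ℂ)
    rw [Complex.norm_real, Real.norm_of_nonneg hlogpos.le] at this
    linarith
  have h3 : |Real.log ‖riemannZeta (sigmaX x : ℂ)‖ - Real.log (Real.log x)| ≤ Real.log 2 := by
    have hpos : 0 < Real.log x / 2 := by linarith
    have hl : Real.log (Real.log x) - Real.log 2 ≤ Real.log ‖riemannZeta (sigmaX x : ℂ)‖ := by
      rw [← Real.log_div hlogpos.ne' (by norm_num)]
      exact Real.log_le_log hpos hlow
    have hu : Real.log ‖riemannZeta (sigmaX x : ℂ)‖ ≤ Real.log 2 + Real.log (Real.log x) := by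
      rw [← Real.log_mul (by norm_num) hlogpos.ne']
      exact Real.log_le_log (hpos.trans_le hlow) hupp
    rw [abs_le]
    constructor <;> linarith
  calc |∑ p ∈ Nat.primesLE ⌊x⌋₊, (p : ℝ)⁻¹ - Real.log (Real.log x)|
      ≤ |∑ p ∈ Nat.primesLE ⌊x⌋₊, (p : ℝ)⁻¹ - (primeSum (fun _ => 1) (sigmaX x : ℂ)).re|
        + |(primeSum (fun _ => 1) (sigmaX x : ℂ)).re - Real.log (Real.log x)| := abs_sub_le _ _ _
    _ ≤ |∑ p ∈ Nat.primesLE ⌊x⌋₊, (p : ℝ)⁻¹ - (primeSum (fun _ => 1) (sigmaX x : ℂ)).re|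
        + (|(primeSum (fun _ => 1) (sigmaX x : ℂ)).re - Real.log ‖riemannZeta (sigmaX x : ℂ)‖|
          + |Real.log ‖riemannZeta (sigmaX x : ℂ)‖ - Real.log (Real.log x)|) := by
        gcongr
        exact abs_sub_le _ _ _
    _ ≤ (1 + Real.log 4 / Real.log 2) + 2 * Real.log 4
        + (∑' p : Nat.Primes, (p : ℝ) ^ (-2 : ℝ)) + Real.log 2 := by
        linarith

/-! ### The distance formula for `𝔻(1, χ(n) n^{it}; x)` -/

open Complex in
/-- `𝔻(1, χ(n)n^{it}; x)² = ∑_{p ≤ x} 1/p - ∑_{p ≤ x} Re(χ(p) p^{it}) / p`. [folklore] -/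
theorem pretentiousDistSq_one_twistedChar_eq {q : ℕ} (χ : DirichletCharacter ℂ q) (t x : ℝ) :
    Sieve.pretentiousDistSq 1 (Sieve.twistedChar χ t) x
      = ∑ p ∈ Nat.primesLE ⌊x⌋₊, (p : ℝ)⁻¹
        - ∑ p ∈ Nat.primesLE ⌊x⌋₊, (χ p * (p : ℂ) ^ ((t : ℂ) * I)).re / p := by
  unfold Sieve.pretentiousDistSq Sieve.twistedChar
  rw [← Finset.sum_sub_distrib]
  refine Finset.sum_congr rfl fun p _ => ?_
  simp only [Pi.one_apply, one_mul, Complex.conj_re]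
  rw [sub_div, one_div]

open Complex in
/-- **(D1a) Distance formula.** There are absolute `x₀ ≥ 3` and `C` such that
`|𝔻(1, χ(n)n^{it}; x)² - (log log x - log |L(σ_x - it, χ)|)| ≤ C` for all `x ≥ x₀`, all moduli
`q`, all Dirichlet characters `χ` mod `q` and all real `t`; here `σ_x = 1 + 1/log x` and
`L(s, χ)` is the Dirichlet series (Mathlib `LSeries`). (cf. Granville–Soundararajan) [folklore] -/
theorem exists_pretentiousDistSq_one_twistedChar_approx :
    ∃ x₀ C : ℝ, 3 ≤ x₀ ∧ ∀ x : ℝ, x₀ ≤ x → ∀ (q : ℕ) (χ : DirichletCharacter ℂ q) (t : ℝ),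
      |Sieve.pretentiousDistSq 1 (Sieve.twistedChar χ t) x
        - (Real.log (Real.log x)
            - Real.log ‖LSeries (fun n : ℕ => χ n) ((sigmaX x : ℂ) - t * I)‖)| ≤ C := by
  obtain ⟨x₀, C₁, hx₀, hC₁⟩ := exists_abs_sum_primesLE_inv_sub_loglog_le
  refine ⟨x₀, C₁ + (((1 + Real.log 4 / Real.log 2) + 2 * Real.log 4)
    + ∑' p : Nat.Primes, (p : ℝ) ^ (-2 : ℝ)), hx₀, fun x hx q χ t => ?_⟩
  have hx3 : 3 ≤ x := hx₀.trans hx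
  have hσre : 1 < ((sigmaX x : ℂ) - t * I).re := by
    simpa using one_lt_sigmaX (by linarith : (1 : ℝ) < x)
  have h1 := hC₁ x hx
  have h2 := abs_sum_re_div_sub_re_primeSum_le (c := fun n : ℕ => χ n)
    (fun n => χ.norm_le_one _) hx3 t
  have h3 := abs_re_primeSum_sub_log_norm_LSeries_le χ hσre
  rw [pretentiousDistSq_one_twistedChar_eq]
  set A := ∑ p ∈ Nat.primesLE ⌊x⌋₊, (p : ℝ)⁻¹
  set B := ∑ p ∈ Nat.primesLE ⌊x⌋₊, (χ p * (p : ℂ) ^ ((t : ℂ) * I)).re / p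
  set P := (primeSum (fun n : ℕ => χ n) ((sigmaX x : ℂ) - t * I)).re
  set Z := Real.log ‖LSeries (fun n : ℕ => χ n) ((sigmaX x : ℂ) - t * I)‖
  set LL := Real.log (Real.log x)
  calc |A - B - (LL - Z)| = |(A - LL) - (B - Z)| := by ring_nf
    _ ≤ |A - LL| + |B - Z| := abs_sub _ _
    _ ≤ C₁ + (|B - P| + |P - Z|) := add_le_add h1 (abs_sub_le _ _ _)
    _ ≤ C₁ + (((1 + Real.log 4 / Real.log 2) + 2 * Real.log 4)
        + ∑' p : Nat.Primes, (p : ℝ) ^ (-2 : ℝ)) := by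
        gcongr

open Complex in
/-- **(D1c) Distance formula for `𝔻(1, n^{iu}; x)`.** With the same absolute `x₀, C`:
`|𝔻(1, n^{iu}; x)² - (log log x - log |ζ(σ_x - iu)|)| ≤ C` for `x ≥ x₀` and all real `u`
(the case `q = 1` of (D1a); `n^{iu}` is `twistedChar (1 : DirichletCharacter ℂ 1) u`).
(cf. Granville–Soundararajan) [folklore] -/
theorem exists_pretentiousDistSq_one_zeta_approx :
    ∃ x₀ C : ℝ, 3 ≤ x₀ ∧ ∀ x : ℝ, x₀ ≤ x → ∀ u : ℝ,
      |Sieve.pretentiousDistSq 1 (Sieve.twistedChar (1 : DirichletCharacter ℂ 1) u) x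
        - (Real.log (Real.log x) - Real.log ‖riemannZeta ((sigmaX x : ℂ) - u * I)‖)| ≤ C := by
  obtain ⟨x₀, C, hx₀, hC⟩ := exists_pretentiousDistSq_one_twistedChar_approx
  refine ⟨x₀, C, hx₀, fun x hx u => ?_⟩
  have hσre : 1 < ((sigmaX x : ℂ) - u * I).re := by
    simpa using one_lt_sigmaX (by linarith : (1 : ℝ) < x)
  have h := hC x hx 1 (1 : DirichletCharacter ℂ 1) u
  rwa [DirichletCharacter.LSeries_modOne_eq, LSeries_one_eq_riemannZeta hσre] at h

end Literature.NumberTheory.LFunctions
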